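import Literature.Geometry.DiscreteGeometry.KissingAngleBounds
import HarnessLib

/-!
# Kertész 1994 — arcs of the azimuth budget: a chain of separated angles in an arc

Topic `Literature/Geometry/DiscreteGeometry`; fourth provefact instalment for the named fact
`kertesz1994_ninePointsHemisphere` (`KerteszNinePointsHemisphere.lean`).  The azimuth-budget proof
(cell record HOME/cf-lit/kertesz/BLUEPRINT.md; `KerteszNorthernPoints.lean`, `KerteszLiftPenalty.lean`,
`KerteszLocalRigidity.lean`) cuts the circle of azimuths about the pole at the three northern points
into arcs and bounds every arc from below by a "walk" through the low points it contains.  This file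
PROVES the two elementary real-variable tools for that (no definitions, no named facts):

* `arccos_le_and_le_of_cos_le` — an angle `x ∈ [0, 2π]` with `cos x ≤ c` satisfies
  `arccos c ≤ x` AND `arccos c ≤ 2π − x` (both arcs between two azimuths obey the pair bound);
* **`arc_lower_bound`** — if a finite non-empty set `S` of reals lies in an arc `[α, β]` with
  `s − α ≥ D_a`, `β − s ≥ D_b` for all `s ∈ S` and `s' − s ≥ G` for all `s < s'` in `S`, then
  `β − α ≥ D_a + D_b + (|S| − 1) G` (induction on the largest element: the walk
  `α → s₁ → ⋯ → s_m → β`);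
* `arc_lower_bound_two` — the exact form for `|S| = 2`: `β − α = (a − α) + (b − a) + (β − b)`.

## References
* G. Kertész, *Nine points on the hemisphere*, Colloq. Math. Soc. János Bolyai 63 (1994) 189–196;
  Zbl 0822.52005 (successive narrowing of the relative longitudes). [`Kertesz1994`]
-/

noncomputable section

namespace Literature.Geometry.DiscreteGeometry

open Real

/-- **Both arcs obey the pair bound.**  If `0 ≤ x ≤ 2π` and `cos x ≤ c`, then `arccos c ≤ x` and
`arccos c ≤ 2π − x`.  (For `c > 1`, `arccos c = 0`; for `c < −1` the hypothesis is void; otherwise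
`cos x ≤ cos (arccos c)` with `arccos c ∈ [0, π]` and `cos` strictly decreasing on `[0, π]`, applied to
`x` or to `2π − x`.) [cite: Kertesz1994, proof (relative longitudes)] -/
theorem arccos_le_and_le_of_cos_le {x c : ℝ} (hx0 : 0 ≤ x) (hx1 : x ≤ 2 * π) (h : cos x ≤ c) :
    arccos c ≤ x ∧ arccos c ≤ 2 * π - x := by
  have hBπ : arccos c ≤ π := Real.arccos_le_pi c
  have hB0 : 0 ≤ arccos c := Real.arccos_nonneg c
  -- `cos x ≤ cos (arccos c)`
  have hc : cos x ≤ cos (arccos c) := by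
    by_cases hc1 : c ≤ 1
    · by_cases hc2 : -1 ≤ c
      · rw [Real.cos_arccos hc2 hc1]; exact h
      · have : cos x < -1 := lt_of_le_of_lt h (lt_of_not_ge hc2)
        linarith [Real.neg_one_le_cos x]
    · rw [Real.arccos_of_one_le (le_of_not_ge hc1), Real.cos_zero]
      exact Real.cos_le_one x
  have key : ∀ y, 0 ≤ y → y ≤ π → cos y ≤ cos (arccos c) → arccos c ≤ y := by
    intro y hy0 hyπ hy
    by_contra hlt
    have := Real.cos_lt_cos_of_nonneg_of_le_pi hy0 hBπ (lt_of_not_ge hlt)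
    linarith
  by_cases hxπ : x ≤ π
  · exact ⟨key x hx0 hxπ hc, hBπ.trans (by linarith)⟩
  · have hxπ' : π < x := lt_of_not_ge hxπ
    refine ⟨hBπ.trans hxπ'.le, key (2 * π - x) (by linarith) (by linarith) ?_⟩
    rwa [Real.cos_two_pi_sub]

/-- **The walk through an arc.**  Let `S` be a non-empty finite set of reals with `D_a ≤ s − α` and
`D_b ≤ β − s` for every `s ∈ S`, and `G ≤ s' − s` whenever `s < s'` both lie in `S`.  Then
`D_a + D_b + (|S| − 1) · G ≤ β − α`: sorting `S = {s₁ < ⋯ < s_m}`,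
`β − α = (s₁ − α) + Σ (s_{i+1} − s_i) + (β − s_m)`.  (In the azimuth budget: `α, β` are the
azimuths of two northern points, `S` the azimuths of the low points between them, `D_a, D_b` the
high–low bounds, `G` the low–low bound.) [cite: Kertesz1994, proof (relative longitudes)] -/
theorem arc_lower_bound {α β Da Db G : ℝ} (S : Finset ℝ) (hne : S.Nonempty)
    (hα : ∀ s ∈ S, Da ≤ s - α) (hβ : ∀ s ∈ S, Db ≤ β - s)
    (hG : ∀ s ∈ S, ∀ s' ∈ S, s < s' → G ≤ s' - s) :
    Da + Db + ((S.card : ℝ) - 1) * G ≤ β - α := by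
  classical
  -- induction on the largest element, generalising the right end `β` and its bound `Db`
  revert β Db
  induction S using Finset.induction_on_max with
  | empty => exact absurd hne (Finset.not_nonempty_empty)
  | insert a s hlt ih =>
    intro β Db hβ
    have ha : a ∈ insert a s := Finset.mem_insert_self a s
    have has : a ∉ s := fun h => lt_irrefl a (hlt a h)
    rw [Finset.card_insert_of_notMem has]
    by_cases hs : s.Nonempty
    · -- walk through `s` up to `a`, then from `a` to `β`
      have hα' : ∀ x ∈ s, Da ≤ x - α := fun x hx => hα x (Finset.mem_insert_of_mem hx)
      have hG' : ∀ x ∈ s, ∀ x' ∈ s, x < x' → G ≤ x' - x := fun x hx x' hx' h =>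
        hG x (Finset.mem_insert_of_mem hx) x' (Finset.mem_insert_of_mem hx') h
      have hβ' : ∀ x ∈ s, G ≤ a - x := fun x hx =>
        hG x (Finset.mem_insert_of_mem hx) a ha (hlt x hx)
      have h1 := ih hs hα' hG' hβ'
      have h2 := hβ a ha
      push_cast
      nlinarith [h1, h2]
    · -- `s = ∅`: the arc is `α → a → β`
      rw [Finset.not_nonempty_iff_eq_empty] at hs
      subst hs
      have h1 := hα a ha
      have h2 := hβ a ha
      simp only [Finset.card_empty]
      push_cast
      linarith

/-- **The exact walk through an arc with two points**: for `a < b`,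
`β − α = (a − α) + (b − a) + (β − b)`, so the arc is at least the sum of the three pair bounds.
[cite: Kertesz1994, proof (relative longitudes)] -/
theorem arc_lower_bound_two {α β a b Ba Bab Bb : ℝ} (h1 : Ba ≤ a - α) (h2 : Bab ≤ b - a)
    (h3 : Bb ≤ β - b) : Ba + Bab + Bb ≤ β - α := by
  linarith

end Literature.Geometry.DiscreteGeometry

end
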